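/-
Origin: expansion seat `planner-pub-hodgecm-mc-axioms-1-g14-0`, handover #W40 2026-08-20T15:53:55Z md5 82e441a9a3be (PKG e1fd800669f8 → 82e441a9a3be; 104 l.; MECHANICAL (iib-R) rewrite v3.1 of the PKG file as it stands (88 token edits; rules R1x1+RX[h₂]x87)) (`HOME/mc/pub-hodgecm-mc-axioms-1-g14/revendor/kit-r55/stage55/HodgeCM/Model/E2InstanceR16KE.lean`, md5 82e441a9a3be, 104 lines);
landed by the gen-22 packager (p-g22) in gate run 55 REPLACES the earlier landed copy of `HodgeCM/Model/E2InstanceR16KE.lean` (seat copy carried the packager Origin header of an earlier run (stripped)).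
-/
/-
Origin: CONSTRUCTION seat `planner-pub-hodgecm-mc-axioms-3-g7-0` (unit pub-hodgecm-mc-axioms-3-g7), lever (L-iii♭) T2,
2026-08-19 (generator `mk_E_wrapper.py` by axioms-3-g6; generated by axioms-3-g7 from the NOT-YET-INSTALLED RUN-36 kit parent glue-1-g5 t35 #336 `E2InstanceR16K` ″ 7510a9d9e384, SHAPE-built over glue-1's private stand-ins for period-1 #1081/#1094/#1095 (V-betti world); install only AFTER that parent).  NEW additive leaf `HodgeCM/Model/E2InstanceR16KE.lean` (E naming word glue-1-g5 09:37:47Z: suffix `E` on the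
wrapped term).  Imports: the parent leaf `E2InstanceR16K` and the vendored twin of the tree file
`Literature/NumberTheory/Automorphic/PicardCMEigenbasis.lean` ((L-iii♭) T1).  Generated mechanically by
`mk_E_wrapper.py` from the parent headline `Model.perL_picardCMK_r16`: binder names and order byte-identical; in binder TYPES the
universe parameter `h₃` is replaced by the bridged instance `cmAbelianVarietyRealised_of_eigenbasis hHD_holds hI_holds h₃`.
No proof holes.  Expected `#print axioms`: {propext, Classical.choice, Quot.sound}.
-/
import Summits.HodgeConjecture.HodgeCM.Model.E2InstanceR16K
import Literature.NumberTheory.Automorphic.PicardCMEigenbasis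

/-!
# E2 instance, revision 16KE: the headline `Model.perL_picardCMK_r16` over record (iii)♭

Record (iii) `PicardCM.CMAbelianVarietyRealised` (a principal CM abelian variety of a given CM type, the type
read on ALL of `H¹ = H^{1,0} ⊕ H^{0,1}`) is replaced, as the universe parameter `h₃`, by the citation-lighter
record (iii)♭ `PicardCM.CMAbelianVarietyEigenbasisRealised` (the same `(A, ι)`, the CM type read on the
holomorphic one-forms `H^{1,0} = 𝔇₀(A)` only, Shimura 1998 §5.2) through the KERNEL bridge
`PicardCM.cmAbelianVarietyRealised_of_eigenbasis hHD hI : (iii)♭ → (iii)` (Shimura §3.2 "`M ∼ S ⊕ S̄`" is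
degree-one Hodge theory: `H¹ = H^{1,0} ⊕ conj H^{1,0}`).  `hHD_holds`, `hI_holds` are the package's KERNEL
witnesses of (R-HD)/(R-I) (`UniverseKernel.lean`, period-1 #1095) at which the K parent is stated.  One-line proof: the parent headline at the bridged instance.

* `Model.perL_picardCMK_r16E` — `Model.perL_picardCMK_r16` with `(h₃ : CMAbelianVarietyEigenbasisRealised)`.

Bounce-isolated: nothing imports this file; if it is not installed, `Model.perL_picardCMK_r16` stands.
-/

noncomputable section

open scoped TensorProduct InnerProductSpace Matrix

namespace HodgeCM

namespace Model

open HodgeCM.Universe (AdelicThetaCore AdelicThetaCore₀ SideData ThetaModel ModelAxiomsPerL)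
open Literature.AlgebraicGeometry.HodgeTheory
open Literature.AlgebraicGeometry.ComplexMultiplication (Shimura1998_Thm3_isogenousPower Shimura1998_Thm2_Cor)
open Literature.NumberTheory.Automorphic.PicardCM
open Literature.NumberTheory.Transcendental (Arapura2012_Cor_15_4_6)
open HodgeCM.CMTypeOps (inflate)
open HodgeCM.Model.SupplyResidual (ClassSupplyPackN)
open HodgeCM.Model.ThetaSpace

variable (h₁ : BallQuotientUniformised)  (h₃ : CMAbelianVarietyEigenbasisRealised)

/-- **E2 instance, revision 16KE — HEADLINE over record (iii)♭.** `Model.perL_picardCMK_r16` at the universe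
parameter `h₃ := cmAbelianVarietyRealised_of_eigenbasis hHD_holds hI_holds h₃`, `h₃ : CMAbelianVarietyEigenbasisRealised`;
all other binders verbatim. -/
theorem perL_picardCMK_r16E (h : Bool)
    (hA : Arapura2012_Cor_15_4_6)
    (W : ∀ {L : CMField} {ι₁ : L →+* ℂ} (V : HermSpace3 L ι₁) (c : SeesawCtx L), WmInput V c.D)
    (S : ∀ {L : CMField} {ι₁ : L →+* ℂ} (V : HermSpace3 L ι₁) (c : SeesawCtx L), ThetaAdelicSide V c)
    (μ : ∀ {L : CMField}, SeesawCtx L → Fin 4 → NumberField.InfinitePlace L → ℤ)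
    (hR : DeligneMilne1982_Thm_6_20_full)
    (hLiu : ∀ {L : CMField} {ι₁ : L →+* ℂ} (V : HermSpace3 L ι₁) (c : SeesawCtx L),
      (thetaModelOf hHD_holds hI_holds h₁ (cmAbelianVarietyRealised_of_eigenbasis hHD_holds hI_holds h₃) h (embOf hHD_holds hI_holds h₁ (cmAbelianVarietyRealised_of_eigenbasis hHD_holds hI_holds h₃)) (coverOf hHD_holds hI_holds h₁ (cmAbelianVarietyRealised_of_eigenbasis hHD_holds hI_holds h₃) hA) (wmOfInput W) (thetaOf _ (thetaClassInputOf _ (fun V c => thetaSpaceInputOf hHD_holds hI_holds h₁ (cmAbelianVarietyRealised_of_eigenbasis hHD_holds hI_holds h₃) S V c))) (d12Of μ) (d34Of μ)).GoodCtx ι₁ c → Module.finrank ℚ c.K = 6 →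
      ∀ (i : Fin 4) (Γ : Level V), ∃ (M : CMField) (k : c.K →+* M) (σ' : M →+* ℂ), σ'.comp k = c.σ ∧
        (thetaModelOf hHD_holds hI_holds h₁ (cmAbelianVarietyRealised_of_eigenbasis hHD_holds hI_holds h₃) h (embOf hHD_holds hI_holds h₁ (cmAbelianVarietyRealised_of_eigenbasis hHD_holds hI_holds h₃)) (coverOf hHD_holds hI_holds h₁ (cmAbelianVarietyRealised_of_eigenbasis hHD_holds hI_holds h₃) hA) (wmOfInput W) (thetaOf _ (thetaClassInputOf _ (fun V c => thetaSpaceInputOf hHD_holds hI_holds h₁ (cmAbelianVarietyRealised_of_eigenbasis hHD_holds hI_holds h₃) S V c))) (d12Of μ) (d34Of μ)).Theta V c i Γ ⊆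
          (picardCMUniverse hHD_holds hI_holds h₁ (cmAbelianVarietyRealised_of_eigenbasis hHD_holds hI_holds h₃)).Uiso Γ M (inflate k (c.Ψ i)) σ')
    (C : ∀ {L : CMField} {ι₁ : L →+* ℂ} (V : HermSpace3 L ι₁) (c : SeesawCtx L) (hV : IsAnisotropic L V.Hm),
      (thetaModelOf hHD_holds hI_holds h₁ (cmAbelianVarietyRealised_of_eigenbasis hHD_holds hI_holds h₃) h (embOf hHD_holds hI_holds h₁ (cmAbelianVarietyRealised_of_eigenbasis hHD_holds hI_holds h₃)) (coverOf hHD_holds hI_holds h₁ (cmAbelianVarietyRealised_of_eigenbasis hHD_holds hI_holds h₃) hA) (wmOfInput W) (thetaOf _ (thetaClassInputOf _ (fun V c => thetaSpaceInputOf hHD_holds hI_holds h₁ (cmAbelianVarietyRealised_of_eigenbasis hHD_holds hI_holds h₃) S V c))) (d12Of μ) (d34Of μ)).GoodCtx ι₁ c →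
      Module.finrank ℚ c.K = 6 → ∀ k : Fin 4, k = 0 ∨ k = 1 → ∀ N : ℕ, 0 < N →
        ArchKTypeData (thetaSpaceInputIn hHD_holds hI_holds h₁ (cmAbelianVarietyRealised_of_eigenbasis hHD_holds hI_holds h₃) (S V c) hV) k N)
    (hT : ∀ {L : CMField} {ι₁ : L →+* ℂ} (V : HermSpace3 L ι₁) (c : SeesawCtx L) (k : Fin 4) (N : ℕ),
      ((S V c).P k).IsThetaArchContinuous N)
    (hpd : ∀ {L : CMField} {ι₁ : L →+* ℂ} (V : HermSpace3 L ι₁) (c : SeesawCtx L) (hV : IsAnisotropic L V.Hm)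
      (hc : (thetaModelOf hHD_holds hI_holds h₁ (cmAbelianVarietyRealised_of_eigenbasis hHD_holds hI_holds h₃) h (embOf hHD_holds hI_holds h₁ (cmAbelianVarietyRealised_of_eigenbasis hHD_holds hI_holds h₃)) (coverOf hHD_holds hI_holds h₁ (cmAbelianVarietyRealised_of_eigenbasis hHD_holds hI_holds h₃) hA) (wmOfInput W) (thetaOf _ (thetaClassInputOf _ (fun V c => thetaSpaceInputOf hHD_holds hI_holds h₁ (cmAbelianVarietyRealised_of_eigenbasis hHD_holds hI_holds h₃) S V c))) (d12Of μ) (d34Of μ)).GoodCtx ι₁ c)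
      (h6 : Module.finrank ℚ c.K = 6) (k : Fin 4) (hk : k = 0 ∨ k = 1) (N : ℕ) (hN : 0 < N),
      (C V c hV hc h6 k hk N hN).IsWeaklyPDiff Literature.AlgebraicGeometry.ShimuraVarieties.BallForms.expP)
    (hk : ∀ {L : CMField} {ι₁ : L →+* ℂ} (V : HermSpace3 L ι₁) (c : SeesawCtx L) (hV : IsAnisotropic L V.Hm)
      (hc : (thetaModelOf hHD_holds hI_holds h₁ (cmAbelianVarietyRealised_of_eigenbasis hHD_holds hI_holds h₃) h (embOf hHD_holds hI_holds h₁ (cmAbelianVarietyRealised_of_eigenbasis hHD_holds hI_holds h₃)) (coverOf hHD_holds hI_holds h₁ (cmAbelianVarietyRealised_of_eigenbasis hHD_holds hI_holds h₃) hA) (wmOfInput W) (thetaOf _ (thetaClassInputOf _ (fun V c => thetaSpaceInputOf hHD_holds hI_holds h₁ (cmAbelianVarietyRealised_of_eigenbasis hHD_holds hI_holds h₃) S V c))) (d12Of μ) (d34Of μ)).GoodCtx ι₁ c)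
      (h6 : Module.finrank ℚ c.K = 6) (k : Fin 4) (hk : k = 0 ∨ k = 1) (N : ℕ) (hN : 0 < N),
      (C V c hV hc h6 k hk N hN).IsPMinusKilled Literature.AlgebraicGeometry.ShimuraVarieties.BallForms.expP)
    (gen12 : ∀ {L : CMField} {ι₁ : L →+* ℂ} (V : HermSpace3 L ι₁) (c : SeesawCtx L),
      (thetaModelOf hHD_holds hI_holds h₁ (cmAbelianVarietyRealised_of_eigenbasis hHD_holds hI_holds h₃) h (embOf hHD_holds hI_holds h₁ (cmAbelianVarietyRealised_of_eigenbasis hHD_holds hI_holds h₃)) (coverOf hHD_holds hI_holds h₁ (cmAbelianVarietyRealised_of_eigenbasis hHD_holds hI_holds h₃) hA) (wmOfInput W) (thetaOf _ (thetaClassInputOf _ (fun V c => thetaSpaceInputOf hHD_holds hI_holds h₁ (cmAbelianVarietyRealised_of_eigenbasis hHD_holds hI_holds h₃) S V c))) (d12Of μ) (d34Of μ)).GoodCtx ι₁ c → Module.finrank ℚ c.K = 6 →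
      Nonempty ((thetaModelOf hHD_holds hI_holds h₁ (cmAbelianVarietyRealised_of_eigenbasis hHD_holds hI_holds h₃) h (embOf hHD_holds hI_holds h₁ (cmAbelianVarietyRealised_of_eigenbasis hHD_holds hI_holds h₃)) (coverOf hHD_holds hI_holds h₁ (cmAbelianVarietyRealised_of_eigenbasis hHD_holds hI_holds h₃) hA) (wmOfInput W) (thetaOf _ (thetaClassInputOf _ (fun V c => thetaSpaceInputOf hHD_holds hI_holds h₁ (cmAbelianVarietyRealised_of_eigenbasis hHD_holds hI_holds h₃) S V c))) (d12Of μ) (d34Of μ)).Gen12FunBridge V c))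
    (real34 : ∀ {L : CMField} {ι₁ : L →+* ℂ} (V : HermSpace3 L ι₁) (c : SeesawCtx L),
      (thetaModelOf hHD_holds hI_holds h₁ (cmAbelianVarietyRealised_of_eigenbasis hHD_holds hI_holds h₃) h (embOf hHD_holds hI_holds h₁ (cmAbelianVarietyRealised_of_eigenbasis hHD_holds hI_holds h₃)) (coverOf hHD_holds hI_holds h₁ (cmAbelianVarietyRealised_of_eigenbasis hHD_holds hI_holds h₃) hA) (wmOfInput W) (thetaOf _ (thetaClassInputOf _ (fun V c => thetaSpaceInputOf hHD_holds hI_holds h₁ (cmAbelianVarietyRealised_of_eigenbasis hHD_holds hI_holds h₃) S V c))) (d12Of μ) (d34Of μ)).GoodCtx ι₁ c → Module.finrank ℚ c.K = 6 →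
      Nonempty ((thetaModelOf hHD_holds hI_holds h₁ (cmAbelianVarietyRealised_of_eigenbasis hHD_holds hI_holds h₃) h (embOf hHD_holds hI_holds h₁ (cmAbelianVarietyRealised_of_eigenbasis hHD_holds hI_holds h₃)) (coverOf hHD_holds hI_holds h₁ (cmAbelianVarietyRealised_of_eigenbasis hHD_holds hI_holds h₃) hA) (wmOfInput W) (thetaOf _ (thetaClassInputOf _ (fun V c => thetaSpaceInputOf hHD_holds hI_holds h₁ (cmAbelianVarietyRealised_of_eigenbasis hHD_holds hI_holds h₃) S V c))) (d12Of μ) (d34Of μ)).Real34FunBridge V c))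
    (hyp12 : ∀ {L : CMField} {ι₁ : L →+* ℂ} (V : HermSpace3 L ι₁) (c : SeesawCtx L),
      (thetaModelOf hHD_holds hI_holds h₁ (cmAbelianVarietyRealised_of_eigenbasis hHD_holds hI_holds h₃) h (embOf hHD_holds hI_holds h₁ (cmAbelianVarietyRealised_of_eigenbasis hHD_holds hI_holds h₃)) (coverOf hHD_holds hI_holds h₁ (cmAbelianVarietyRealised_of_eigenbasis hHD_holds hI_holds h₃) hA) (wmOfInput W) (thetaOf _ (thetaClassInputOf _ (fun V c => thetaSpaceInputOf hHD_holds hI_holds h₁ (cmAbelianVarietyRealised_of_eigenbasis hHD_holds hI_holds h₃) S V c))) (d12Of μ) (d34Of μ)).GoodCtx ι₁ c → Module.finrank ℚ c.K = 6 →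
      Nonempty (((coreOf _ (embOf hHD_holds hI_holds h₁ (cmAbelianVarietyRealised_of_eigenbasis hHD_holds hI_holds h₃)) (coverOf hHD_holds hI_holds h₁ (cmAbelianVarietyRealised_of_eigenbasis hHD_holds hI_holds h₃) hA) (wmOfInput W) (thetaOf _ (thetaClassInputOf _ (fun V c => thetaSpaceInputOf hHD_holds hI_holds h₁ (cmAbelianVarietyRealised_of_eigenbasis hHD_holds hI_holds h₃) S V c)))).toCore h).HypSmoothCore12
        (((coreOf _ (embOf hHD_holds hI_holds h₁ (cmAbelianVarietyRealised_of_eigenbasis hHD_holds hI_holds h₃)) (coverOf hHD_holds hI_holds h₁ (cmAbelianVarietyRealised_of_eigenbasis hHD_holds hI_holds h₃) hA) (wmOfInput W) (thetaOf _ (thetaClassInputOf _ (fun V c => thetaSpaceInputOf hHD_holds hI_holds h₁ (cmAbelianVarietyRealised_of_eigenbasis hHD_holds hI_holds h₃) S V c)))).toCore h).side12 (d12Of μ)) (((coreOf _ (embOf hHD_holds hI_holds h₁ (cmAbelianVarietyRealised_of_eigenbasis hHD_holds hI_holds h₃)) (coverOf hHD_holds hI_holds h₁ (cmAbelianVarietyRealised_of_eigenbasis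 hHD_holds hI_holds h₃) hA) (wmOfInput W) (thetaOf _ (thetaClassInputOf _ (fun V c => thetaSpaceInputOf hHD_holds hI_holds h₁ (cmAbelianVarietyRealised_of_eigenbasis hHD_holds hI_holds h₃) S V c)))).toCore h).side34 (d34Of μ))
        ((((coreOf _ (embOf hHD_holds hI_holds h₁ (cmAbelianVarietyRealised_of_eigenbasis hHD_holds hI_holds h₃)) (coverOf hHD_holds hI_holds h₁ (cmAbelianVarietyRealised_of_eigenbasis hHD_holds hI_holds h₃) hA) (wmOfInput W) (thetaOf _ (thetaClassInputOf _ (fun V c => thetaSpaceInputOf hHD_holds hI_holds h₁ (cmAbelianVarietyRealised_of_eigenbasis hHD_holds hI_holds h₃) S V c)))).toCore h).analyticKM (((coreOf _ (embOf hHD_holds hI_holds h₁ (cmAbelianVarietyRealised_of_eigenbasis hHD_holds hI_holds h₃)) (coverOf hHD_holds hI_holds h₁ (cmAbelianVarietyRealised_of_eigenbasis hHD_holds hI_holds h₃) hA) (wmOfInput W) (thetaOf _ (thetaClassInputOf _ (fun V c => thetaSpaceInputOf hHD_holds hI_holds h₁ (cmAbelianVarietyRealised_of_eigenbasis hHD_holds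 hI_holds h₃) S V c)))).toCore h).side12 (d12Of μ))
          (((coreOf _ (embOf hHD_holds hI_holds h₁ (cmAbelianVarietyRealised_of_eigenbasis hHD_holds hI_holds h₃)) (coverOf hHD_holds hI_holds h₁ (cmAbelianVarietyRealised_of_eigenbasis hHD_holds hI_holds h₃) hA) (wmOfInput W) (thetaOf _ (thetaClassInputOf _ (fun V c => thetaSpaceInputOf hHD_holds hI_holds h₁ (cmAbelianVarietyRealised_of_eigenbasis hHD_holds hI_holds h₃) S V c)))).toCore h).side34 (d34Of μ))).toAnalytic) V c (ℓ := linOfInput W V c)))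
    (hyp34 : ∀ {L : CMField} {ι₁ : L →+* ℂ} (V : HermSpace3 L ι₁) (c : SeesawCtx L),
      (thetaModelOf hHD_holds hI_holds h₁ (cmAbelianVarietyRealised_of_eigenbasis hHD_holds hI_holds h₃) h (embOf hHD_holds hI_holds h₁ (cmAbelianVarietyRealised_of_eigenbasis hHD_holds hI_holds h₃)) (coverOf hHD_holds hI_holds h₁ (cmAbelianVarietyRealised_of_eigenbasis hHD_holds hI_holds h₃) hA) (wmOfInput W) (thetaOf _ (thetaClassInputOf _ (fun V c => thetaSpaceInputOf hHD_holds hI_holds h₁ (cmAbelianVarietyRealised_of_eigenbasis hHD_holds hI_holds h₃) S V c))) (d12Of μ) (d34Of μ)).GoodCtx ι₁ c → Module.finrank ℚ c.K = 6 →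
      Nonempty (((coreOf _ (embOf hHD_holds hI_holds h₁ (cmAbelianVarietyRealised_of_eigenbasis hHD_holds hI_holds h₃)) (coverOf hHD_holds hI_holds h₁ (cmAbelianVarietyRealised_of_eigenbasis hHD_holds hI_holds h₃) hA) (wmOfInput W) (thetaOf _ (thetaClassInputOf _ (fun V c => thetaSpaceInputOf hHD_holds hI_holds h₁ (cmAbelianVarietyRealised_of_eigenbasis hHD_holds hI_holds h₃) S V c)))).toCore h).HypSmoothCore34
        (((coreOf _ (embOf hHD_holds hI_holds h₁ (cmAbelianVarietyRealised_of_eigenbasis hHD_holds hI_holds h₃)) (coverOf hHD_holds hI_holds h₁ (cmAbelianVarietyRealised_of_eigenbasis hHD_holds hI_holds h₃) hA) (wmOfInput W) (thetaOf _ (thetaClassInputOf _ (fun V c => thetaSpaceInputOf hHD_holds hI_holds h₁ (cmAbelianVarietyRealised_of_eigenbasis hHD_holds hI_holds h₃) S V c)))).toCore h).side12 (d12Of μ)) (((coreOf _ (embOf hHD_holds hI_holds h₁ (cmAbelianVarietyRealised_of_eigenbasis hHD_holds hI_holds h₃)) (coverOf hHD_holds hI_holds h₁ (cmAbelianVarietyRealised_of_eigenbasis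 hHD_holds hI_holds h₃) hA) (wmOfInput W) (thetaOf _ (thetaClassInputOf _ (fun V c => thetaSpaceInputOf hHD_holds hI_holds h₁ (cmAbelianVarietyRealised_of_eigenbasis hHD_holds hI_holds h₃) S V c)))).toCore h).side34 (d34Of μ))
        ((((coreOf _ (embOf hHD_holds hI_holds h₁ (cmAbelianVarietyRealised_of_eigenbasis hHD_holds hI_holds h₃)) (coverOf hHD_holds hI_holds h₁ (cmAbelianVarietyRealised_of_eigenbasis hHD_holds hI_holds h₃) hA) (wmOfInput W) (thetaOf _ (thetaClassInputOf _ (fun V c => thetaSpaceInputOf hHD_holds hI_holds h₁ (cmAbelianVarietyRealised_of_eigenbasis hHD_holds hI_holds h₃) S V c)))).toCore h).analyticKM (((coreOf _ (embOf hHD_holds hI_holds h₁ (cmAbelianVarietyRealised_of_eigenbasis hHD_holds hI_holds h₃)) (coverOf hHD_holds hI_holds h₁ (cmAbelianVarietyRealised_of_eigenbasis hHD_holds hI_holds h₃) hA) (wmOfInput W) (thetaOf _ (thetaClassInputOf _ (fun V c => thetaSpaceInputOf hHD_holds hI_holds h₁ (cmAbelianVarietyRealised_of_eigenbasis hHD_holds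 hI_holds h₃) S V c)))).toCore h).side12 (d12Of μ))
          (((coreOf _ (embOf hHD_holds hI_holds h₁ (cmAbelianVarietyRealised_of_eigenbasis hHD_holds hI_holds h₃)) (coverOf hHD_holds hI_holds h₁ (cmAbelianVarietyRealised_of_eigenbasis hHD_holds hI_holds h₃) hA) (wmOfInput W) (thetaOf _ (thetaClassInputOf _ (fun V c => thetaSpaceInputOf hHD_holds hI_holds h₁ (cmAbelianVarietyRealised_of_eigenbasis hHD_holds hI_holds h₃) S V c)))).toCore h).side34 (d34Of μ))).toAnalytic) V c (ℓ := linOfInput W V c))) :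
     (picardCMUniverseK h₁ (cmAbelianVarietyRealised_of_eigenbasis hHD_holds hI_holds h₃)).PerL :=
  perL_picardCMK_r16 h₁ (cmAbelianVarietyRealised_of_eigenbasis hHD_holds hI_holds h₃)
    h hA W S μ hR hLiu C hT hpd hk gen12 real34 hyp12 hyp34

end Model

end HodgeCM
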